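import Literature.IUT.LogThetaLattice.DHodgeTheaterSignSynchronization

/-!
# `±`-synchronization at the `ℱ`-level: the strip projection `†ℋ𝒯^{Θ±ell} ↦ †𝔉_≻` on isomorphisms ([IUTchI] Def 6.11 (iii), Cor 6.12 (i); [IUTchIII] Prop 1.3 (i), Rmk 1.3.1)

Mochizuki, *Inter-universal Teichmüller Theory I*, kurims manuscript (May 2020), §6, Cor 5.3 (ii) p.144, Def 6.11 (iii)
p.173, Cor 6.12 (i) p.173; *III*, kurims (May 2020), Prop 1.3 (i) p.42, Rmk 1.3.1 p.43, Thm 1.5 (i) p.48. PROOF-ONLY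
companion (theorems, no definitions) by the L6 cone prover abc-iut-w4-d017, the `ℱ`-level sequel of
`DHodgeTheaterSignSynchronization.lean` (this seat, p417155), over abc-iut-L6-t3's `FHodgeTheaterGroupoid.lean`
(`HTRep FK`, `HTRep.FRepIso`, `HTRep.codFunctor : †ℋ𝒯^{Θ±ell} ↦ †𝔉_≻`, `StripFrame.ofKits` field `strip`); nothing restated.
DAG nodes IUTchIII:Prop1.3(i) / IUTchIII:Thm1.5(i). ([IUTchI] Def 6.11 (iii) p.173) [claim: Mochizuki2012, status: disputed].

The strip log-links of [IUTchIII] Prop 1.3 (i) are poly-isomorphisms of `ℱ`-prime-strips `log(†𝔉_□) ⥲ ‡𝔉_□` induced by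
(representatives of) isomorphisms of `Θ^{±ell}`-Hodge theaters. UNDER abc-iut-L5-t4's named [IUTchI] Cor 5.3 (ii)
(`FKit.IsomFtoDBijective` — the PARAMETER `hbij` of `StripFrame.ofKits`; every `𝒟`-prime-strip isomorphism lifts uniquely to
the `ℱ`-level), the `𝒟`-level results of p417155 transfer verbatim:
* `HTRep.FRepIso.labMap_assocDMap_cod_eq_refl_iff` — for a representative automorphism of `†ℋ𝒯^{Θ±ell}`, the sign of the
  associated `𝒟`-constituent at `†𝔇_{≻,v}` is the same at every `v` (no hypothesis; via `cod_lifts` + p417155);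
* `HTRep.FRepIso.cod_not_surjective` / `HTRep.codFunctor_mapIso_not_surjective` / `StripFrame.ofKits_strip_mapIso_not_surjective`
  — for `v ≠ w ∈ 𝕍`, `Isom(†ℋ𝒯^{Θ±ell}, ‡ℋ𝒯^{Θ±ell}) → Isom(†𝔉_≻, ‡𝔉_≻)` is NOT surjective (given Cor 5.3 (ii)): the `ℱ`-prime-strip
  poly-isomorphism induced by the full poly-isomorphism of Hodge theaters is `±`-synchronized, not full — at the real frame
  `StripFrame.ofKits` this is the field `strip □` through which every log-link is read.
HONEST FRAMING: elementary consequences of the typed definitions, conditional on the named [IUTchI] Cor 5.3 (ii) where stated;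
no new `Prop` fact; nothing here bears on [IUTchIII] Cor 3.12; typed ≠ proved for the series' claims; no side taken.
-/

namespace Literature.IUT.LogThetaLattice

open CategoryTheory
open Literature.IUT.HodgeTheaters Literature.IUT.HodgeTheaters.PMBaseKit

universe u

variable {l : ℕ} {K : PMBaseKit.{u} l} {M : K.MultKit} {FK : K.FKit M}

namespace HTRep

namespace FRepIso

variable {H H₁ H₂ : FK.ThetaPMEllHT}

/-- **IUTchI:Def6.11(iii)** (kurims p.173) `±`-SYNCHRONIZATION at the `ℱ`-level: for a representative automorphism `a` of a
`Θ^{±ell}`-Hodge theater, the `𝒟`-constituent `𝒟(a_≻)_v ∈ Aut(†𝒟_{≻,v})` of its `†𝔉_≻`-component (which lifts the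
`𝒟`-representative's `≻`-constituent, field `cod_lifts`) is positive at `v` iff it is positive at `w` — p417155's
`DRepIso.labMap_cod_eq_refl_iff` for `a.toD`. ([IUTchI] Def 6.11 (iii) p.173) [claim: Mochizuki2012, status: disputed] -/
theorem labMap_assocDMap_cod_eq_refl_iff (a : FRepIso H H) (v w : K.V) :
    K.labMap v (FKit.FStrip.assocDMap a.cod v) = Equiv.refl _ ↔
      K.labMap w (FKit.FStrip.assocDMap a.cod w) = Equiv.refl _ := by
  rw [a.cod_lifts]
  exact a.toD.labMap_cod_eq_refl_iff v w

/-- **IUTchI:Cor6.12(i)** (kurims p.173) NON-SURJECTIVITY at the `ℱ`-level: under [IUTchI] Cor 5.3 (ii) (`FKit.IsomFtoDBijective`) and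
for `v ≠ w ∈ 𝕍`, NOT every isomorphism of `ℱ`-prime-strips `†𝔉_≻ ⥲ ‡𝔉_≻` is the `≻`-component of a representative
`†ℋ𝒯^{Θ±ell} ⥲ ‡ℋ𝒯^{Θ±ell}`: lift a non-induced `𝒟`-isomorphism (p417155 `DRepIso.cod_not_surjective`) along Cor 5.3 (ii)
(`FRepIso.liftIso`). ([IUTchI] Cor 6.12 (i) p.173) [claim: Mochizuki2012, status: disputed] -/
theorem cod_not_surjective (hbij : FK.IsomFtoDBijective) (H₁ H₂ : FK.ThetaPMEllHT) {v w : K.V} (hvw : v ≠ w) :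
    ¬ Function.Surjective (fun f : FRepIso H₁ H₂ => f.cod) := by
  intro hs
  refine DHTRep.DRepIso.cod_not_surjective H₁.dHT H₂.dHT hvw fun δ => ?_
  obtain ⟨f, hf⟩ := hs (liftIso hbij δ)
  refine ⟨f.toD, ?_⟩
  change f.toD.cod = δ
  rw [← f.cod_lifts]
  have hf' : f.cod = liftIso hbij δ := hf
  rw [hf', assocDMap_liftIso]

end FRepIso

/-- **IUTchIII:Prop1.3(i)** (kurims p.42) FUNCTOR FORM: under [IUTchI] Cor 5.3 (ii) and for `v ≠ w ∈ 𝕍`, the strip projection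
`HTRep.codFunctor : †ℋ𝒯^{Θ±ell} ↦ †𝔉_≻` is NOT surjective on isomorphisms between any two objects — the `ℱ`-prime-strip
poly-isomorphism induced by the full poly-isomorphism of `Θ^{±ell}`-Hodge theaters is `±`-synchronized, never full.
([IUTchIII] Prop 1.3 (i) p.42) [claim: Mochizuki2012, status: disputed] -/
theorem codFunctor_mapIso_not_surjective (hbij : FK.IsomFtoDBijective) {v w : K.V} (hvw : v ≠ w) (X Y : HTRep FK) :
    ¬ Function.Surjective (fun ξ : X ≅ Y => HTRep.codFunctor.mapIso ξ) := by
  rw [PrimeStripGroupoids.surjective_mapIso_iff]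
  exact FRepIso.cod_not_surjective hbij X.out Y.out hvw

end HTRep

/-! ### At the real frame `StripFrame.ofKits`: the field `strip` -/

section Frame

open AsSmallTransport

variable (L : FK.MonoLaws) (hbij : FK.IsomFtoDBijective) (hsurj : FK.IsomFmtoDmSurjective) (hR : FK.RlfOfIsStrip)
  (X : TimesMuSide FK L)

/-- **IUTchIII:Prop1.3(i)** (kurims p.42) SMALL-MODEL FORM: the `ℱ`-level strip projection transported to `AsSmall (HTRep FK)` (the shape
of the frame field `strip`) is not surjective on isomorphisms, under Cor 5.3 (ii) and for `v ≠ w ∈ 𝕍`.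
([IUTchIII] Prop 1.3 (i) p.42) [claim: Mochizuki2012, status: disputed] -/
theorem AsSmallTransport.liftF_htCodFunctor_mapIso_not_surjective (hbij : FK.IsomFtoDBijective) {v w : K.V} (hvw : v ≠ w)
    (A B : AsSmall.{max 1 u} (HTRep FK)) :
    ¬ Function.Surjective (fun f : A ≅ B => (liftF (HTRep.codFunctor (FK := FK))).mapIso f) := by
  intro hs
  refine HTRep.codFunctor_mapIso_not_surjective hbij hvw (ULift.down A) (ULift.down B) fun g => ?_
  obtain ⟨f, hf⟩ := hs ((isoEquiv _ _).symm g)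
  refine ⟨isoEquiv A B f, (isoEquiv _ _).symm.injective ?_⟩
  have e := congrFun (liftF_mapIso_eq (HTRep.codFunctor (FK := FK)) A B) f
  simp only [Function.comp_apply] at e
  rw [← e]
  exact hf

/-- **IUTchIII:Thm1.5(i)** (kurims p.48) AT THE REAL FRAME `StripFrame.ofKits`: for `v ≠ w ∈ 𝕍`, the `ℱ`-level strip projection
`strip □ : HT ⥤ F` (`†ℋ𝒯 ↦ †𝔉_□`, `□ = ≻`) — through which every strip log-link `log(†𝔉_□) ⥲ ‡𝔉_□` of [IUTchIII] Prop 1.3 (i) is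
read — is NOT surjective on isomorphisms between any two Hodge theaters (the frame's own parameter `hbij` = [IUTchI] Cor 5.3 (ii)
supplies the lifting). So the `ℱ`-prime-strip poly-isomorphism induced by the full log-link is `±`-synchronized, not full
([IUTchIII] Rmk 1.3.1 p.43), exactly as at the `𝒟`-level (p417155 `StripFrame.ofKits_dstrip_mapIso_not_surjective`).
([IUTchIII] Thm 1.5 (i) p.48) [claim: Mochizuki2012, status: disputed] -/
theorem StripFrame.ofKits_strip_mapIso_not_surjective {v w : K.V} (hvw : v ≠ w)
    (lab : (StripFrame.ofKits L hbij hsurj hR X).Label) (A B : (StripFrame.ofKits L hbij hsurj hR X).HT) :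
    ¬ Function.Surjective (fun ξ : A ≅ B => ((StripFrame.ofKits L hbij hsurj hR X).strip lab).mapIso ξ) :=
  AsSmallTransport.liftF_htCodFunctor_mapIso_not_surjective hbij hvw A B

end Frame

end Literature.IUT.LogThetaLattice
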